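import Summits.Ventures.HodgeRepro2.T5AntidiagonalForm
import Summits.Ventures.HodgeRepro2.T5HeisenbergCommutator
import Summits.Ventures.HodgeRepro2.T5CongruenceConjugation

/-!
# T5HermitianThreeElements — `U(2,1)` for the Gram matrix `antidiag(1, u, 1)`: entrywise membership, the
row relations, the two unipotent radicals, the torus and the Weyl element

Blind cell pub-hodge-repro2, seat p8, Tier-5 kernel support. The record's unitary group at an inert place is
`U(V_v) = U(antidiag(1, u, 1))` in a basis `e, e₀, f` of a self-dual lattice (T5AntidiagonalForm). This file
prepares its Cartan decomposition (T5CartanUnitaryThree) in the style of the rank-one case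
(T5HyperbolicUnitaryElements / T5CartanUnitaryRankOne). p3's T5HeisenbergCommutator (p392076) already holds
`unitaryJ a = {g ∈ GL₃(E) | gᴴ J_a g = J_a}` with `J_a = !![0,0,1; 0,a,0; 1,0,0]`, the Heisenberg elements
`heisUnit a y z = !![1, −a star y, z; 0, 1, y; 0, 0, 1]` with `heisUnit_mem_unitaryJ_iff`, and
`conjTranspose_fin_three`; these are REUSED BY IMPORT (`formUnitaryGroup_J3` is the dictionary
`formUnitaryGroup (J3 u) = unitaryJ u`, and `upper3 u x z = heisUnit u (−star x / u) z` the reparametrisation).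

* `J3_eq`: `antidiag(1, u, 1) = !![0, 0, 1; 0, u, 0; 1, 0, 0]`; `mem_iff_fin_three`: `!![a,b,c; d,e,f; p,q,r] ∈ U`
  iff the NINE column relations hold (`gᴴ J g = J` entrywise);
* `mul_Jinv_conjTranspose` / `row_relations`: `g J⁻¹ gᴴ = J⁻¹` — the nine ROW relations;
* `upper3 u x z = !![1, x, z; 0, 1, −star x / u; 0, 0, 1]` and `lower3 u y w = !![1, 0, 0; y, 1, 0; w, −star y / u, 1]`
  (the two unipotent radicals) with their inverses, membership (`z + star z + star x · x / u = 0`) and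
  integrality; the torus `diag(α, β, γ) ∈ U` iff `star α · γ = 1` and `star β · β = 1`; the Weyl element
  `J₃ = P_rev` (`J₃ ∈ U`, `J₃ ∈ GL₃(R)`, `J₃` reverses rows / columns).

Hypotheses throughout: `u ≠ 0` and `star u = u` (the anisotropic coefficient, a star-fixed unit for the
record). Nothing about a valuation yet.
-/

namespace Summit.Ventures.HodgeRepro2.T5HermitianThreeElements

open Summit.Ventures.HodgeRepro2 Matrix

section Map

variable {R E : Type*} [CommRing R] [CommRing E]

/-- Entrywise image of an explicit `3 × 3` matrix. -/
theorem map_fin_three (φ : R →+* E) (a b c d e f p q r : R) :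
    (!![a, b, c; d, e, f; p, q, r]).map φ = !![φ a, φ b, φ c; φ d, φ e, φ f; φ p, φ q, φ r] := by
  ext i j
  fin_cases i <;> fin_cases j <;> rfl

omit [CommRing E] in
/-- Equality of explicit `3 × 3` matrices, entrywise. -/
theorem fin_three_eq_iff (a b c d e f p q r a' b' c' d' e' f' p' q' r' : E) :
    !![a, b, c; d, e, f; p, q, r] = !![a', b', c'; d', e', f'; p', q', r'] ↔
      a = a' ∧ b = b' ∧ c = c' ∧ d = d' ∧ e = e' ∧ f = f' ∧ p = p' ∧ q = q' ∧ r = r' := by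
  constructor
  · intro h
    exact ⟨congrFun (congrFun h 0) 0, congrFun (congrFun h 0) 1, congrFun (congrFun h 0) 2,
      congrFun (congrFun h 1) 0, congrFun (congrFun h 1) 1, congrFun (congrFun h 1) 2,
      congrFun (congrFun h 2) 0, congrFun (congrFun h 2) 1, congrFun (congrFun h 2) 2⟩
  · rintro ⟨rfl, rfl, rfl, rfl, rfl, rfl, rfl, rfl, rfl⟩
    rfl

end Map

section NoStar

variable {E : Type*} [CommRing E]

/-- The Gram matrix `antidiag(1, u, 1)` of the record's hermitian space at an inert place. -/
abbrev J3 (u : E) : Matrix (Fin 3) (Fin 3) E := T5AntidiagonalForm.antidiagonalMatrix ![1, u, 1]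

/-- `antidiag(1, u, 1) = !![0, 0, 1; 0, u, 0; 1, 0, 0]`. -/
theorem J3_eq (u : E) : J3 u = !![0, 0, 1; 0, u, 0; 1, 0, 0] := by
  ext i j
  fin_cases i <;> fin_cases j <;> rfl

/-- The Weyl element `J₃ = P_rev` on the matrices. -/
theorem coe_permUnit_rev3 :
    ((T5CartanDominant.permUnit E (Fin.revPerm : Equiv.Perm (Fin 3)) : GL (Fin 3) E) :
      Matrix (Fin 3) (Fin 3) E) = !![0, 0, 1; 0, 1, 0; 1, 0, 0] := by
  rw [T5CartanDominant.coe_permUnit]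
  ext i j
  fin_cases i <;> fin_cases j <;> rfl

/-- Right multiplication by `J₃` reverses the columns. -/
theorem mul_permUnit_rev3 (g : GL (Fin 3) E) (a b c d e f p q r : E)
    (hg : (g : Matrix (Fin 3) (Fin 3) E) = !![a, b, c; d, e, f; p, q, r]) :
    ((g * T5CartanDominant.permUnit E (Fin.revPerm : Equiv.Perm (Fin 3)) : GL (Fin 3) E) :
      Matrix (Fin 3) (Fin 3) E) = !![c, b, a; f, e, d; r, q, p] := by
  rw [Units.val_mul, hg, coe_permUnit_rev3, Matrix.mul_fin_three]
  simp

/-- Left multiplication by `J₃` reverses the rows. -/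
theorem permUnit_rev3_mul (g : GL (Fin 3) E) (a b c d e f p q r : E)
    (hg : (g : Matrix (Fin 3) (Fin 3) E) = !![a, b, c; d, e, f; p, q, r]) :
    ((T5CartanDominant.permUnit E (Fin.revPerm : Equiv.Perm (Fin 3)) * g : GL (Fin 3) E) :
      Matrix (Fin 3) (Fin 3) E) = !![p, q, r; d, e, f; a, b, c] := by
  rw [Units.val_mul, hg, coe_permUnit_rev3, Matrix.mul_fin_three]
  simp

/-- The torus element `diag(ϖ^k, 1, ϖ^{-k}) = diagonalUnit (fun i => ϖ ^ m i)`, `m = ![k, 0, −k]`, on the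
matrices. -/
theorem coe_diagonalUnit_zpow_fin_three (ϖ : Eˣ) (k : ℤ) :
    (T5CartanUniformiser.diagonalUnit (fun i => ϖ ^ (![k, 0, -k] i)) : Matrix (Fin 3) (Fin 3) E) =
      !![((ϖ ^ k : Eˣ) : E), 0, 0; 0, 1, 0; 0, 0, ((ϖ ^ (-k) : Eˣ) : E)] := by
  rw [T5CartanUniformiser.coe_diagonalUnit]
  ext i j
  fin_cases i <;> fin_cases j <;> simp

/-- The diagonal `diag(α, β, γ)` as a unit, for units `α, β, γ`, on the matrices. -/
theorem coe_diagonalUnit_fin_three (α β γ : Eˣ) :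
    (T5CartanUniformiser.diagonalUnit ![α, β, γ] : Matrix (Fin 3) (Fin 3) E) =
      !![(α : E), 0, 0; 0, (β : E), 0; 0, 0, (γ : E)] := by
  rw [T5CartanUniformiser.coe_diagonalUnit]
  ext i j
  fin_cases i <;> fin_cases j <;> rfl

end NoStar

section Star

variable {E : Type*} [Field E] [StarRing E]

/-- THE DICTIONARY: p8's `formUnitaryGroup (antidiag(1, u, 1))` is p3's `unitaryJ u`. -/
theorem formUnitaryGroup_J3 (u : E) :
    T5UnitaryGroupForm.formUnitaryGroup (J3 u) = T5HeisenbergCommutator.unitaryJ u := by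
  ext g
  rw [T5UnitaryGroupForm.mem_formUnitaryGroup_iff, T5HeisenbergCommutator.mem_unitaryJ_iff, J3_eq]
  rfl

/-- MEMBERSHIP IN `U(antidiag(1, u, 1))`, entrywise: the nine column relations `gᴴ J g = J`. -/
theorem mem_iff_fin_three (u : E) (g : GL (Fin 3) E) (a b c d e f p q r : E)
    (hg : (g : Matrix (Fin 3) (Fin 3) E) = !![a, b, c; d, e, f; p, q, r]) :
    g ∈ T5UnitaryGroupForm.formUnitaryGroup (J3 u) ↔
      star p * a + star d * u * d + star a * p = 0 ∧
      star p * b + star d * u * e + star a * q = 0 ∧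
      star p * c + star d * u * f + star a * r = 1 ∧
      star q * a + star e * u * d + star b * p = 0 ∧
      star q * b + star e * u * e + star b * q = u ∧
      star q * c + star e * u * f + star b * r = 0 ∧
      star r * a + star f * u * d + star c * p = 1 ∧
      star r * b + star f * u * e + star c * q = 0 ∧
      star r * c + star f * u * f + star c * r = 0 := by
  rw [T5UnitaryGroupForm.mem_formUnitaryGroup_iff, hg, J3_eq, T5HeisenbergCommutator.conjTranspose_fin_three,
    Matrix.mul_fin_three, Matrix.mul_fin_three, fin_three_eq_iff]
  simp only [mul_zero, add_zero, zero_add, mul_one]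

omit [StarRing E] in
/-- `J⁻¹ = antidiag(1, u⁻¹, 1)`: `J · J⁻¹ = 1`. -/
theorem J3_mul_J3inv (u : E) (hu0 : u ≠ 0) :
    (!![0, 0, 1; 0, u, 0; 1, 0, 0] : Matrix (Fin 3) (Fin 3) E) * !![0, 0, 1; 0, u⁻¹, 0; 1, 0, 0] = 1 := by
  rw [Matrix.mul_fin_three, Matrix.one_fin_three, fin_three_eq_iff]
  refine ⟨by ring, by ring, by ring, by ring, ?_, by ring, by ring, by ring, by ring⟩
  field_simp
  ring

omit [StarRing E] in
/-- `J⁻¹ · J = 1`. -/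
theorem J3inv_mul_J3 (u : E) (hu0 : u ≠ 0) :
    (!![0, 0, 1; 0, u⁻¹, 0; 1, 0, 0] : Matrix (Fin 3) (Fin 3) E) * !![0, 0, 1; 0, u, 0; 1, 0, 0] = 1 := by
  rw [Matrix.mul_fin_three, Matrix.one_fin_three, fin_three_eq_iff]
  refine ⟨by ring, by ring, by ring, by ring, ?_, by ring, by ring, by ring, by ring⟩
  field_simp
  ring

/-- THE ROW RELATIONS: `g ∈ U(J)` gives `g · J⁻¹ · gᴴ = J⁻¹`. -/
theorem mul_Jinv_conjTranspose (u : E) (hu0 : u ≠ 0) {g : GL (Fin 3) E}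
    (hg : g ∈ T5UnitaryGroupForm.formUnitaryGroup (J3 u)) :
    (g : Matrix (Fin 3) (Fin 3) E) * !![0, 0, 1; 0, u⁻¹, 0; 1, 0, 0] * (g : Matrix (Fin 3) (Fin 3) E)ᴴ =
      !![0, 0, 1; 0, u⁻¹, 0; 1, 0, 0] := by
  rw [T5UnitaryGroupForm.mem_formUnitaryGroup_iff, J3_eq] at hg
  set A : Matrix (Fin 3) (Fin 3) E := (g : Matrix (Fin 3) (Fin 3) E)
  set B : Matrix (Fin 3) (Fin 3) E := ((g⁻¹ : GL (Fin 3) E) : Matrix (Fin 3) (Fin 3) E)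
  set J : Matrix (Fin 3) (Fin 3) E := !![0, 0, 1; 0, u, 0; 1, 0, 0]
  set J' : Matrix (Fin 3) (Fin 3) E := !![0, 0, 1; 0, u⁻¹, 0; 1, 0, 0]
  have hAB : A * B = 1 := Units.mul_inv g
  have hJJ' : J * J' = 1 := J3_mul_J3inv u hu0
  have hJ'J : J' * J = 1 := J3inv_mul_J3 u hu0
  -- A J' (Aᴴ J A) B = A J' J B = A B = 1
  have h1 : A * J' * (Aᴴ * J * A) * B = 1 := by
    rw [hg]
    calc A * J' * J * B = A * (J' * J) * B := by simp only [Matrix.mul_assoc]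
      _ = 1 := by rw [hJ'J, Matrix.mul_one, hAB]
  -- hence (A J' Aᴴ) (J A B) = 1, i.e. (A J' Aᴴ) J = 1
  have h2 : A * J' * Aᴴ * J = 1 := by
    calc A * J' * Aᴴ * J = A * J' * (Aᴴ * J * A) * B := by
          rw [← Matrix.mul_one (A * J' * Aᴴ * J), ← hAB]
          simp only [Matrix.mul_assoc]
      _ = 1 := h1
  calc A * J' * Aᴴ = A * J' * Aᴴ * (J * J') := by rw [hJJ', Matrix.mul_one]
    _ = (A * J' * Aᴴ * J) * J' := by simp only [Matrix.mul_assoc]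
    _ = J' := by rw [h2, Matrix.one_mul]

/-- The nine ROW relations of `g = !![a,b,c; d,e,f; p,q,r] ∈ U(antidiag(1, u, 1))`. -/
theorem row_relations (u : E) (hu0 : u ≠ 0) (g : GL (Fin 3) E) (a b c d e f p q r : E)
    (hg : (g : Matrix (Fin 3) (Fin 3) E) = !![a, b, c; d, e, f; p, q, r])
    (hmem : g ∈ T5UnitaryGroupForm.formUnitaryGroup (J3 u)) :
    c * star a + b * u⁻¹ * star b + a * star c = 0 ∧
    c * star d + b * u⁻¹ * star e + a * star f = 0 ∧
    c * star p + b * u⁻¹ * star q + a * star r = 1 ∧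
    f * star a + e * u⁻¹ * star b + d * star c = 0 ∧
    f * star d + e * u⁻¹ * star e + d * star f = u⁻¹ ∧
    f * star p + e * u⁻¹ * star q + d * star r = 0 ∧
    r * star a + q * u⁻¹ * star b + p * star c = 1 ∧
    r * star d + q * u⁻¹ * star e + p * star f = 0 ∧
    r * star p + q * u⁻¹ * star q + p * star r = 0 := by
  have h := mul_Jinv_conjTranspose u hu0 hmem
  rw [hg, T5HeisenbergCommutator.conjTranspose_fin_three, Matrix.mul_fin_three, Matrix.mul_fin_three,
    fin_three_eq_iff] at h
  simpa only [mul_zero, add_zero, zero_add, mul_one] using h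

/-- The upper unipotent `n(x, z) = !![1, x, z; 0, 1, −star x / u; 0, 0, 1]` as a unit. -/
def upper3 (u x z : E) : GL (Fin 3) E where
  val := !![1, x, z; 0, 1, -star x / u; 0, 0, 1]
  inv := !![1, -x, x * (-star x / u) - z; 0, 1, star x / u; 0, 0, 1]
  val_inv := by
    rw [Matrix.mul_fin_three, Matrix.one_fin_three, fin_three_eq_iff]
    exact ⟨by ring, by ring, by ring, by ring, by ring, by ring, by ring, by ring, by ring⟩
  inv_val := by
    rw [Matrix.mul_fin_three, Matrix.one_fin_three, fin_three_eq_iff]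
    exact ⟨by ring, by ring, by ring, by ring, by ring, by ring, by ring, by ring, by ring⟩

/-- The lower unipotent `n⁻(y, w) = !![1, 0, 0; y, 1, 0; w, −u · star y, 1]` as a unit. -/
def lower3 (u y w : E) : GL (Fin 3) E where
  val := !![1, 0, 0; y, 1, 0; w, -(u * star y), 1]
  inv := !![1, 0, 0; -y, 1, 0; y * (-(u * star y)) - w, u * star y, 1]
  val_inv := by
    rw [Matrix.mul_fin_three, Matrix.one_fin_three, fin_three_eq_iff]
    exact ⟨by ring, by ring, by ring, by ring, by ring, by ring, by ring, by ring, by ring⟩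
  inv_val := by
    rw [Matrix.mul_fin_three, Matrix.one_fin_three, fin_three_eq_iff]
    exact ⟨by ring, by ring, by ring, by ring, by ring, by ring, by ring, by ring, by ring⟩

/-- `upper3` on the matrices. -/
theorem coe_upper3 (u x z : E) :
    (upper3 u x z : Matrix (Fin 3) (Fin 3) E) = !![1, x, z; 0, 1, -star x / u; 0, 0, 1] := rfl

/-- `lower3` on the matrices. -/
theorem coe_lower3 (u y w : E) :
    (lower3 u y w : Matrix (Fin 3) (Fin 3) E) = !![1, 0, 0; y, 1, 0; w, -(u * star y), 1] := rfl

/-- The inverse of `n(x, z)` is `n(−x, x · (−star x / u) − z)`. -/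
theorem upper3_inv (u x z : E) :
    (upper3 u x z)⁻¹ = upper3 u (-x) (x * (-star x / u) - z) := by
  apply Units.ext
  show !![1, -x, x * (-star x / u) - z; 0, 1, star x / u; 0, 0, 1] = _
  rw [coe_upper3, star_neg, neg_div, neg_neg]

/-- The inverse of `n⁻(y, w)` is `n⁻(−y, y · (−u · star y) − w)`. -/
theorem lower3_inv (u y w : E) :
    (lower3 u y w)⁻¹ = lower3 u (-y) (y * (-(u * star y)) - w) := by
  apply Units.ext
  show !![1, 0, 0; -y, 1, 0; y * (-(u * star y)) - w, u * star y, 1] = _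
  rw [coe_lower3, fin_three_eq_iff]
  exact ⟨rfl, rfl, rfl, rfl, rfl, rfl, rfl, by rw [star_neg]; ring, rfl⟩

/-- `upper3 u x z` is p3's Heisenberg element `heisUnit u (−star x / u) z` (for `star u = u`, `u ≠ 0`). -/
theorem upper3_eq_heisUnit (u : E) (hu : star u = u) (hu0 : u ≠ 0) (x z : E) :
    upper3 u x z = T5HeisenbergCommutator.heisUnit u (-star x / u) z := by
  apply Units.ext
  show !![1, x, z; 0, 1, -star x / u; 0, 0, 1] = !![1, -(u * star (-star x / u)), z; 0, 1, -star x / u; 0, 0, 1]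
  rw [fin_three_eq_iff]
  refine ⟨rfl, ?_, rfl, rfl, rfl, rfl, rfl, rfl, rfl⟩
  rw [star_div₀, star_neg, star_star, hu]
  field_simp

/-- `n(x, z) ∈ U(antidiag(1, u, 1))` when `z + star z + star x · x / u = 0` (`star u = u`, `u ≠ 0`) — p3's
`heisUnit_mem_unitaryJ_iff` through the dictionary. -/
theorem upper3_mem (u : E) (hu : star u = u) (hu0 : u ≠ 0) {x z : E}
    (hz : z + star z + star x * x / u = 0) :
    upper3 u x z ∈ T5UnitaryGroupForm.formUnitaryGroup (J3 u) := by
  rw [formUnitaryGroup_J3, upper3_eq_heisUnit u hu hu0, T5HeisenbergCommutator.heisUnit_mem_unitaryJ_iff u hu]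
  rw [star_div₀, star_neg, star_star, hu]
  have hz' := hz
  field_simp at hz'
  field_simp
  linear_combination hz'

/-- `n⁻(y, w) ∈ U(antidiag(1, u, 1))` when `w + star w + u · star y · y = 0`. -/
theorem lower3_mem (u : E) (hu : star u = u) {y w : E}
    (hw : w + star w + u * star y * y = 0) :
    lower3 u y w ∈ T5UnitaryGroupForm.formUnitaryGroup (J3 u) := by
  rw [mem_iff_fin_three u _ 1 0 0 y 1 0 w (-(u * star y)) 1 rfl]
  simp only [star_zero, star_one, mul_zero, zero_mul, add_zero, zero_add, mul_one, one_mul, star_neg,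
    star_mul, star_star, hu, and_true, true_and]
  refine ⟨by linear_combination hw, by ring, by ring⟩

/-- `diag(α, β, γ) ∈ U(antidiag(1, u, 1))` when `star α · γ = 1` and `star β · β = 1`. -/
theorem diagonalUnit_mem (u : E) {α β γ : Eˣ} (h1 : star (α : E) * γ = 1)
    (h2 : star (β : E) * β = 1) :
    T5CartanUniformiser.diagonalUnit ![α, β, γ] ∈ T5UnitaryGroupForm.formUnitaryGroup (J3 u) := by
  rw [mem_iff_fin_three u _ (α : E) 0 0 0 (β : E) 0 0 0 (γ : E) (coe_diagonalUnit_fin_three α β γ)]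
  have h3 : star (γ : E) * α = 1 := by
    have := congrArg star h1
    rw [star_mul, star_star, star_one] at this
    exact this
  simp only [star_zero, mul_zero, zero_mul, add_zero, zero_add, h1, h3, and_true, true_and]
  rw [mul_comm (star (β : E)) u, mul_assoc, h2, mul_one]

/-- `J₃ ∈ U(antidiag(1, u, 1))` (persymmetry of `antidiag(1, u, 1)`). -/
theorem permUnit_rev3_mem (u : E) :
    T5CartanDominant.permUnit E (Fin.revPerm : Equiv.Perm (Fin 3)) ∈
      T5UnitaryGroupForm.formUnitaryGroup (J3 u) :=
  T5AntidiagonalForm.permUnit_rev_mem_antidiagonal ![1, u, 1] (fun i => by fin_cases i <;> rfl)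

end Star

section Integral

variable {R : Type*} [CommRing R] {E : Type*} [Field E] [StarRing E] [Algebra R E] [IsFractionRing R E]

/-- `n(x, z) ∈ GL₃(R)` for `x`, `z` and `star x / u` integral. -/
theorem upper3_mem_range {u x z : E} (hx : IsLocalization.IsInteger R x)
    (hz : IsLocalization.IsInteger R z) (hx' : IsLocalization.IsInteger R (star x / u)) :
    upper3 u x z ∈ (Matrix.GeneralLinearGroup.map (algebraMap R E)).range := by
  obtain ⟨rx, hrx⟩ := hx
  obtain ⟨rz, hrz⟩ := hz
  obtain ⟨rx', hrx'⟩ := hx'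
  refine T5CongruenceConjugation.mem_range_of_map_eq (IsFractionRing.injective R E) (upper3 u x z)
    !![1, rx, rz; 0, 1, -rx'; 0, 0, 1] !![1, -rx, -(rx * rx') - rz; 0, 1, rx'; 0, 0, 1] ?_ ?_
  · rw [map_fin_three, map_one, map_zero, map_neg, hrx, hrz, hrx', coe_upper3, neg_div]
  · rw [map_fin_three, map_one, map_zero, map_neg, map_sub, map_neg, map_mul, hrx, hrz, hrx']
    show !![1, -x, x * (-star x / u) - z; 0, 1, star x / u; 0, 0, 1] = _
    rw [fin_three_eq_iff]
    refine ⟨rfl, rfl, by rw [neg_div]; ring, rfl, rfl, rfl, rfl, rfl, rfl⟩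

/-- `n⁻(y, w) ∈ GL₃(R)` for `y`, `w` and `u · star y` integral. -/
theorem lower3_mem_range {u y w : E} (hy : IsLocalization.IsInteger R y)
    (hw : IsLocalization.IsInteger R w) (hy' : IsLocalization.IsInteger R (u * star y)) :
    lower3 u y w ∈ (Matrix.GeneralLinearGroup.map (algebraMap R E)).range := by
  obtain ⟨ry, hry⟩ := hy
  obtain ⟨rw', hrw⟩ := hw
  obtain ⟨ry', hry'⟩ := hy'
  refine T5CongruenceConjugation.mem_range_of_map_eq (IsFractionRing.injective R E) (lower3 u y w)
    !![1, 0, 0; ry, 1, 0; rw', -ry', 1] !![1, 0, 0; -ry, 1, 0; -(ry * ry') - rw', ry', 1] ?_ ?_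
  · rw [map_fin_three, map_one, map_zero, map_neg, hry, hrw, hry', coe_lower3]
  · rw [map_fin_three, map_one, map_zero, map_neg, map_sub, map_neg, map_mul, hry, hrw, hry']
    show !![1, 0, 0; -y, 1, 0; y * (-(u * star y)) - w, u * star y, 1] = _
    rw [fin_three_eq_iff]
    refine ⟨rfl, rfl, rfl, rfl, rfl, rfl, by ring, rfl, rfl⟩

omit [StarRing E] in
/-- `diag(α, β, γ) ∈ GL₃(R)` for `α, β, γ` integral with integral inverses. -/
theorem diagonalUnit_mem_range {α β γ : Eˣ} (hα : IsLocalization.IsInteger R (α : E))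
    (hα' : IsLocalization.IsInteger R ((α⁻¹ : Eˣ) : E)) (hβ : IsLocalization.IsInteger R (β : E))
    (hβ' : IsLocalization.IsInteger R ((β⁻¹ : Eˣ) : E)) (hγ : IsLocalization.IsInteger R (γ : E))
    (hγ' : IsLocalization.IsInteger R ((γ⁻¹ : Eˣ) : E)) :
    T5CartanUniformiser.diagonalUnit ![α, β, γ] ∈ (Matrix.GeneralLinearGroup.map (algebraMap R E)).range := by
  obtain ⟨ra, hra⟩ := hα
  obtain ⟨ra', hra'⟩ := hα'
  obtain ⟨rb, hrb⟩ := hβ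
  obtain ⟨rb', hrb'⟩ := hβ'
  obtain ⟨rc, hrc⟩ := hγ
  obtain ⟨rc', hrc'⟩ := hγ'
  refine T5CongruenceConjugation.mem_range_of_map_eq (IsFractionRing.injective R E)
    (T5CartanUniformiser.diagonalUnit ![α, β, γ]) !![ra, 0, 0; 0, rb, 0; 0, 0, rc]
    !![ra', 0, 0; 0, rb', 0; 0, 0, rc'] ?_ ?_
  · rw [map_fin_three, map_zero, hra, hrb, hrc, coe_diagonalUnit_fin_three]
  · rw [map_fin_three, map_zero, hra', hrb', hrc']
    apply Units.inv_eq_of_mul_eq_one_right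
    rw [coe_diagonalUnit_fin_three, Matrix.mul_fin_three, Matrix.one_fin_three]
    simp

omit [StarRing E] [IsFractionRing R E] in
/-- `J₃ ∈ GL₃(R)`. -/
theorem permUnit_rev3_mem_range :
    T5CartanDominant.permUnit E (Fin.revPerm : Equiv.Perm (Fin 3)) ∈
      (Matrix.GeneralLinearGroup.map (algebraMap R E)).range :=
  T5UnitaryGroupForm.permUnit_mem_range _

end Integral

end Summit.Ventures.HodgeRepro2.T5HermitianThreeElements
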